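import Literature.Analysis.FluidPDE.ChaeWolfDSSDecayScaling
import HarnessLib

/-!
# Chae–Wolf 2017, Theorem 1.1 — Step 3: the weighted Serrin-type estimate for DSS fields

Analysis/FluidPDE proofs file (theorems only) on the discharge path of the named fact
`Literature.Analysis.FluidPDE.chaeWolf2017_dss_typeI_decay` (`ChaeWolfRemovingDSS.lean`;
D. Chae, J. Wolf, Comm. PDE 42 (2017) = arXiv:1610.09464, Theorem 1.1). This is the core of
**Step 3** of the printed proof (§2, "3. Serrin type estimate in terms of weighted norm",
arXiv p. 6, (2.3)–(2.5)): for a `λ`-DSS field,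

> `∫_{−∞}^{0} ∫_{B(0,λ) ∖ B(0,1)} |u|ᵖ dx (−t)^{(p−5)/2} dt ≤ (min{1, λ^{5−p}})⁻¹ Σ_{k∈ℤ} ∫_{−λ²}^{−1} ∫_{D_k} |u|ᵖ`
> `≤ C ‖u‖ᵖ_{L^p(ℝ³ × (−λ², −1))}`, `D_k = B(0, λ^{−k+1}) ∖ B(0, λ^{−k})` (2.4)–(2.5),

by the change of variables `(x, t) ↦ (λᵏx, λ^{2k}t)` on each time block
`t ∈ [−λ^{2k+2}, −λ^{2k})` and discrete self-similarity. Here, in `lintegral` form with the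
weight `(−t)^{(q−5)/2}` for a real exponent `q ≥ 1` and the `ℝ≥0∞`-exponent `ENNReal.ofReal q`:

* `ChaeWolfDecay.iUnion_timeBlock`, `pairwise_disjoint_timeBlock` — the blocks
  `Ioc (−c^{2(k+1)}) (−c^{2k})`, `k ∈ ℤ`, partition `(−∞, 0)`;
* `ChaeWolfDecay.lintegral_block_eq` — the change of variables on one block:
  `∫∫_{B_k × A₁} ‖u‖^q = (cᵏ)^{5−q} ∫∫_{B₀ × D_k} ‖u‖^q` (`A₁ = {1 ≤ |x| < c}`), from the tree's
  exact scaling law `eLpNorm_nsRescale_restrict_preimage` and `u = u_{c^{−k}}`;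
* `ChaeWolfDecay.lintegral_weighted_annulus_le` — **(2.5)**:
  `∫∫_{(−∞,0) × A₁} ‖u‖^q (−t)^{(q−5)/2} ≤ max(1, c^{q−5}) ∫∫_{(−c², −1] × ℝ³} ‖u‖^q`.

The summation over annuli (2.6)–(2.7a) (the `log R` bound) is the same estimate applied to the
rescaled annuli and is not restated.

## Mathlib / tree search

Tree: `eLpNorm_nsRescale_restrict_preimage`, `stAffine` (`ScalingUniformRecurrence`,
`SpaceTimeRescaling`), `IsDiscretelySelfSimilar.zpow`. Mathlib: `lintegral_iUnion`,
`exists_mem_Ico_zpow`, `eLpNorm_eq_lintegral_rpow_enorm`, `ENNReal.rpow_inv_rpow`.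

## References

* D. Chae, J. Wolf, Comm. PDE 42 (2017) = arXiv:1610.09464, §2, Step 3, (2.3)–(2.5), (2.6),
  (2.7a) (arXiv p. 6). [ChaeWolf2017RemovingDSS]
-/

noncomputable section

open MeasureTheory Set Filter Function Metric
open scoped ENNReal NNReal

namespace Literature.Analysis.FluidPDE

namespace ChaeWolfDecay

/-! ### The time blocks `(−c^{2(k+1)}, −c^{2k}]` -/

/-- The `k`-th time block of the scaling with factor `c`: `B_k = (−c^{2(k+1)}, −c^{2k}]`
(written with `(c²)^k`). [cite: ChaeWolf2017RemovingDSS, §2 Step 3 (arXiv p. 6)] -/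
theorem mem_timeBlock_iff {c : ℝ} (k : ℤ) (t : ℝ) :
    t ∈ Ioc (-(c ^ 2) ^ (k + 1)) (-(c ^ 2) ^ k) ↔ (c ^ 2) ^ k ≤ -t ∧ -t < (c ^ 2) ^ (k + 1) := by
  simp only [mem_Ioc]
  constructor <;> intro h <;> constructor <;> linarith [h.1, h.2]

/-- **The time blocks partition `(−∞, 0)`**: `⋃_{k ∈ ℤ} (−c^{2(k+1)}, −c^{2k}] = (−∞, 0)` for
`c > 1` (every `−t > 0` lies in a unique `[(c²)ᵏ, (c²)^{k+1})`, Mathlib `exists_mem_Ico_zpow`). [folklore] -/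
theorem iUnion_timeBlock {c : ℝ} (hc : 1 < c) :
    (⋃ k : ℤ, Ioc (-(c ^ 2) ^ (k + 1)) (-(c ^ 2) ^ k)) = Iio (0 : ℝ) := by
  have hc2 : 1 < c ^ 2 := by nlinarith
  ext t
  simp only [mem_iUnion, mem_Iio]
  constructor
  · rintro ⟨k, hk⟩
    have h0 : 0 < (c ^ 2) ^ k := zpow_pos (by positivity) k
    rw [mem_timeBlock_iff] at hk
    linarith [hk.1]
  · intro ht
    obtain ⟨k, hk1, hk2⟩ := exists_mem_Ico_zpow (neg_pos.2 ht) hc2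
    exact ⟨k, (mem_timeBlock_iff k t).2 ⟨hk1, hk2⟩⟩

/-- The time blocks are pairwise disjoint. [folklore] -/
theorem pairwise_disjoint_timeBlock {c : ℝ} (hc : 1 < c) :
    Pairwise (Disjoint on fun k : ℤ => Ioc (-(c ^ 2) ^ (k + 1)) (-(c ^ 2) ^ k)) := by
  have hc2 : 1 < c ^ 2 := by nlinarith
  intro i j hij
  refine disjoint_left.2 fun t hti htj => hij ?_
  rw [mem_timeBlock_iff] at hti htj
  -- `(c²)^i ≤ -t < (c²)^(j+1)` and `(c²)^j ≤ -t < (c²)^(i+1)` force `i = j`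
  have h1 : (c ^ 2) ^ i < (c ^ 2) ^ (j + 1) := lt_of_le_of_lt hti.1 htj.2
  have h2 : (c ^ 2) ^ j < (c ^ 2) ^ (i + 1) := lt_of_le_of_lt htj.1 hti.2
  have h1' := (zpow_lt_zpow_iff_right₀ hc2).1 h1
  have h2' := (zpow_lt_zpow_iff_right₀ hc2).1 h2
  omega

/-! ### The change of variables on one block -/

/-- The scaling factor of `eLpNorm_nsRescale_restrict_preimage` on `ℝ × ℝ³`, raised to the power
`q`: `(γ (γ⁻⁵)^{1/q})^q = γ^{q − 5}` (`γ > 0`, `q > 0`). [folklore] -/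
theorem rescale_factor_rpow {γ q : ℝ} (hγ : 0 < γ) (hq : 0 < q) :
    (‖γ‖ₑ * (ENNReal.ofReal (γ ^ 2 * γ ^ 3)⁻¹) ^ (1 / ENNReal.ofReal q).toReal) ^ q =
      ENNReal.ofReal (γ ^ (q - 5)) := by
  have h1 : (1 / ENNReal.ofReal q).toReal = 1 / q := by
    rw [one_div, ENNReal.toReal_inv, ENNReal.toReal_ofReal hq.le, one_div]
  have e5 : (γ ^ 2 * γ ^ 3)⁻¹ = γ ^ (-5 : ℝ) := by
    rw [← pow_add, Real.rpow_neg hγ.le]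
    show (γ ^ 5)⁻¹ = (γ ^ ((5 : ℕ) : ℝ))⁻¹
    rw [Real.rpow_natCast]
  rw [h1, Real.enorm_eq_ofReal hγ.le, e5, ENNReal.ofReal_rpow_of_pos (Real.rpow_pos_of_pos hγ _),
    ← Real.rpow_mul hγ.le, ← ENNReal.ofReal_mul hγ.le, ENNReal.ofReal_rpow_of_pos (by positivity),
    Real.mul_rpow hγ.le (Real.rpow_nonneg hγ.le _), ← Real.rpow_mul hγ.le]
  conv_lhs => rw [show γ ^ q = γ ^ (1 * q) by rw [one_mul]]
  rw [← Real.rpow_add hγ]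
  congr 1
  field_simp
  ring

/-- **Preimage of the base block under the parabolic dilation by `γ = c⁻ᵏ`**:
`Φ_γ⁻¹((−c², −1] × D_k) = B_k × A₁` with `A₁ = {1 ≤ |x| < c}`,
`D_k = {c⁻ᵏ ≤ |y| < c^{1−k}}`, `B_k = (−c^{2(k+1)}, −c^{2k}]` (the substitution of (2.4)). [cite: ChaeWolf2017RemovingDSS, §2 Step 3, (2.4) (arXiv p. 6)] -/
theorem preimage_stAffine_baseBlock {c : ℝ} (hc : 1 < c) (k : ℤ) :
    stAffine ((c ^ (-k)) ^ 2) (c ^ (-k)) 0 (0 : EuclideanSpace ℝ (Fin 3)) ⁻¹'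
        (Ioc (-c ^ 2) (-1) ×ˢ
          {y : EuclideanSpace ℝ (Fin 3) | c ^ (-k) ≤ ‖y‖ ∧ ‖y‖ < c * c ^ (-k)}) =
      Ioc (-(c ^ 2) ^ (k + 1)) (-(c ^ 2) ^ k) ×ˢ
        {x : EuclideanSpace ℝ (Fin 3) | 1 ≤ ‖x‖ ∧ ‖x‖ < c} := by
  have hc0 : 0 < c := one_pos.trans hc
  have hγ0 : 0 < c ^ (-k) := zpow_pos hc0 _
  have hg0 : 0 < (c ^ 2) ^ k := zpow_pos (by positivity) k
  have hγsq : (c ^ (-k)) ^ 2 = ((c ^ 2) ^ k)⁻¹ := by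
    rw [zpow_neg, inv_pow, ← zpow_natCast (c ^ k) 2, ← zpow_mul, mul_comm, zpow_mul, zpow_natCast]
  ext ⟨t, x⟩
  simp only [mem_preimage, stAffine_apply, zero_add, mem_prod, mem_Ioc, mem_setOf_eq, norm_smul,
    Real.norm_of_nonneg hγ0.le]
  rw [hγsq, zpow_add_one₀ (by positivity : c ^ 2 ≠ 0) k]
  constructor
  · rintro ⟨⟨h1, h2⟩, h3, h4⟩
    refine ⟨⟨?_, ?_⟩, ?_, ?_⟩
    · rw [inv_mul_eq_div, lt_div_iff₀ hg0] at h1; nlinarith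
    · rw [inv_mul_eq_div, div_le_iff₀ hg0] at h2; nlinarith
    · nlinarith
    · nlinarith
  · rintro ⟨⟨h1, h2⟩, h3, h4⟩
    refine ⟨⟨?_, ?_⟩, ?_, ?_⟩
    · rw [inv_mul_eq_div, lt_div_iff₀ hg0]; nlinarith
    · rw [inv_mul_eq_div, div_le_iff₀ hg0]; nlinarith
    · nlinarith
    · nlinarith

variable {F : Type*} [NormedAddCommGroup F] [NormedSpace ℝ F]

/-- **The change of variables on one block** ((2.4) of Chae–Wolf 2017): for a `c`-DSS field
`u`, `1 < c`, `k ∈ ℤ` and a real exponent `q > 0`,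
`∫∫_{B_k × A₁} ‖u‖^q = (c⁻ᵏ)^{q − 5} ∫∫_{(−c²,−1] × D_k} ‖u‖^q`. [cite: ChaeWolf2017RemovingDSS, §2 Step 3, (2.4) (arXiv p. 6)] -/
theorem lintegral_block_eq {c : ℝ} (hc : 1 < c) {u : ℝ → EuclideanSpace ℝ (Fin 3) → F}
    (h : IsDiscretelySelfSimilar c u) (k : ℤ) {q : ℝ} (hq : 0 < q) :
    ∫⁻ z in Ioc (-(c ^ 2) ^ (k + 1)) (-(c ^ 2) ^ k) ×ˢ
        {x : EuclideanSpace ℝ (Fin 3) | 1 ≤ ‖x‖ ∧ ‖x‖ < c}, ‖u z.1 z.2‖ₑ ^ q =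
      ENNReal.ofReal ((c ^ (-k)) ^ (q - 5)) *
        ∫⁻ z in Ioc (-c ^ 2) (-1) ×ˢ
          {y : EuclideanSpace ℝ (Fin 3) | c ^ (-k) ≤ ‖y‖ ∧ ‖y‖ < c * c ^ (-k)},
            ‖u z.1 z.2‖ₑ ^ q := by
  have hc0 : 0 < c := one_pos.trans hc
  have hγ0 : 0 < c ^ (-k) := zpow_pos hc0 _
  have hp0 : 0 < ENNReal.ofReal q := ENNReal.ofReal_pos.2 hq
  have hpt : ENNReal.ofReal q ≠ ⊤ := ENNReal.ofReal_ne_top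
  have hpq : (ENNReal.ofReal q).toReal = q := ENNReal.toReal_ofReal hq.le
  -- the exact scaling law, with `u_γ = u`
  have hγdss : nsRescale (c ^ (-k)) u = u := h.zpow hc0.ne' (-k)
  have key := eLpNorm_nsRescale_restrict_preimage hγ0 u (ENNReal.ofReal q)
    (Ioc (-c ^ 2) (-1) ×ˢ
      {y : EuclideanSpace ℝ (Fin 3) | c ^ (-k) ≤ ‖y‖ ∧ ‖y‖ < c * c ^ (-k)})
  rw [hγdss, finrank_euclideanSpace_fin, preimage_stAffine_baseBlock hc k] at key
  -- raise to the power `q`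
  have e1 := congrArg (fun a : ℝ≥0∞ => a ^ q) key
  rw [ENNReal.mul_rpow_of_nonneg _ _ hq.le, rescale_factor_rpow hγ0 hq,
    eLpNorm_eq_eLpNorm' hp0.ne' hpt, eLpNorm_eq_eLpNorm' hp0.ne' hpt, hpq,
    ← lintegral_rpow_enorm_eq_rpow_eLpNorm' hq, ← lintegral_rpow_enorm_eq_rpow_eLpNorm' hq] at e1
  exact e1

/-! ### The weighted estimate (2.5) -/

/-- **The weight on one block**: for `t ∈ B_k`, `(−t)^{(q−5)/2} ≤ max(1, c^{q−5}) ((c²)ᵏ)^{(q−5)/2}`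
("`λ^{2k} < −t ≤ λ^{2(k+1)}`" in (2.4)). [cite: ChaeWolf2017RemovingDSS, §2 Step 3, (2.4) (arXiv p. 6)] -/
theorem weight_le_on_timeBlock {c : ℝ} (hc : 1 < c) (k : ℤ) (q : ℝ) {t : ℝ}
    (ht : t ∈ Ioc (-(c ^ 2) ^ (k + 1)) (-(c ^ 2) ^ k)) :
    (-t) ^ ((q - 5) / 2) ≤ max 1 (c ^ (q - 5)) * ((c ^ 2) ^ k) ^ ((q - 5) / 2) := by
  have hc0 : 0 < c := one_pos.trans hc
  rw [mem_timeBlock_iff] at ht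
  have hg0 : 0 < (c ^ 2) ^ k := zpow_pos (by positivity) k
  have hpow : 0 ≤ ((c ^ 2) ^ k) ^ ((q - 5) / 2) := Real.rpow_nonneg hg0.le _
  rcases le_or_gt 0 ((q - 5) / 2) with he | he
  · -- increasing weight: use `-t < (c²)^(k+1) = (c²)^k c²`
    have h1 : (-t) ^ ((q - 5) / 2) ≤ ((c ^ 2) ^ (k + 1)) ^ ((q - 5) / 2) :=
      Real.rpow_le_rpow (by linarith) ht.2.le he
    rw [zpow_add_one₀ (by positivity) k, Real.mul_rpow hg0.le (by positivity)] at h1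
    have h2 : (c ^ 2) ^ ((q - 5) / 2) = c ^ (q - 5) := by
      rw [← Real.rpow_natCast c 2, ← Real.rpow_mul hc0.le]
      congr 1
      push_cast
      ring
    rw [h2] at h1
    calc (-t) ^ ((q - 5) / 2) ≤ ((c ^ 2) ^ k) ^ ((q - 5) / 2) * c ^ (q - 5) := h1
      _ ≤ ((c ^ 2) ^ k) ^ ((q - 5) / 2) * max 1 (c ^ (q - 5)) :=
          mul_le_mul_of_nonneg_left (le_max_right _ _) hpow
      _ = _ := mul_comm _ _
  · -- decreasing weight: use `(c²)^k ≤ -t`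
    have h1 : (-t) ^ ((q - 5) / 2) ≤ ((c ^ 2) ^ k) ^ ((q - 5) / 2) :=
      Real.rpow_le_rpow_of_nonpos hg0 ht.1 he.le
    calc (-t) ^ ((q - 5) / 2) ≤ ((c ^ 2) ^ k) ^ ((q - 5) / 2) := h1
      _ = 1 * ((c ^ 2) ^ k) ^ ((q - 5) / 2) := (one_mul _).symm
      _ ≤ max 1 (c ^ (q - 5)) * ((c ^ 2) ^ k) ^ ((q - 5) / 2) :=
          mul_le_mul_of_nonneg_right (le_max_left _ _) hpow

/-- The two scaling factors cancel: `((c²)ᵏ)^{(q−5)/2} (c⁻ᵏ)^{q−5} = 1`. [folklore] -/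
theorem block_factors_cancel {c : ℝ} (hc : 1 < c) (k : ℤ) (q : ℝ) :
    ((c ^ 2) ^ k) ^ ((q - 5) / 2) * (c ^ (-k)) ^ (q - 5) = 1 := by
  have hc0 : 0 < c := one_pos.trans hc
  have hγ0 : 0 < c ^ (-k) := zpow_pos hc0 _
  have hg0 : 0 < (c ^ 2) ^ k := zpow_pos (by positivity) k
  have hγsq : (c ^ (-k)) ^ 2 = ((c ^ 2) ^ k)⁻¹ := by
    rw [zpow_neg, inv_pow, ← zpow_natCast (c ^ k) 2, ← zpow_mul, mul_comm, zpow_mul, zpow_natCast]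
  have h1 : (c ^ (-k)) ^ (q - 5) = ((c ^ (-k)) ^ 2) ^ ((q - 5) / 2) := by
    rw [← Real.rpow_natCast (c ^ (-k)) 2, ← Real.rpow_mul hγ0.le]
    congr 1
    push_cast
    ring
  rw [h1, hγsq, Real.inv_rpow hg0.le, mul_inv_cancel₀ (Real.rpow_pos_of_pos hg0 _).ne']

/-- The annulus `{a ≤ |x| < b}` is measurable. [folklore] -/
theorem measurableSet_annulus (a b : ℝ) :
    MeasurableSet {x : EuclideanSpace ℝ (Fin 3) | a ≤ ‖x‖ ∧ ‖x‖ < b} :=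
  (measurableSet_le measurable_const continuous_norm.measurable).inter
    (measurableSet_lt continuous_norm.measurable measurable_const)

/-- The dyadic annuli `D_k = {c⁻ᵏ ≤ |y| < c^{1−k}}` are pairwise disjoint (`c > 1`). [folklore] -/
theorem pairwise_disjoint_annulus {c : ℝ} (hc : 1 < c) :
    Pairwise (Disjoint on fun k : ℤ =>
      {y : EuclideanSpace ℝ (Fin 3) | c ^ (-k) ≤ ‖y‖ ∧ ‖y‖ < c * c ^ (-k)}) := by
  have hc0 : 0 < c := one_pos.trans hc
  intro i j hij
  refine disjoint_left.2 fun y hyi hyj => hij ?_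
  simp only [mem_setOf_eq] at hyi hyj
  have e : ∀ k : ℤ, c * c ^ (-k) = c ^ (-k + 1) := fun k => by
    rw [zpow_add_one₀ hc0.ne', mul_comm]
  rw [e] at hyi hyj
  have h1 : c ^ (-i) < c ^ (-j + 1) := lt_of_le_of_lt hyi.1 hyj.2
  have h2 : c ^ (-j) < c ^ (-i + 1) := lt_of_le_of_lt hyj.1 hyi.2
  have h1' := (zpow_lt_zpow_iff_right₀ hc).1 h1
  have h2' := (zpow_lt_zpow_iff_right₀ hc).1 h2
  omega

/-- **Chae–Wolf 2017, (2.5): the weighted Serrin-type estimate on the base annulus.** For a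
`c`-discretely self-similar field `u : ℝ → ℝ³ → F`, `1 < c`, and a real exponent `q > 0`,
`∫_{−∞}^{0} ∫_{1 ≤ |x| < c} |u|^q (−t)^{(q−5)/2} dx dt ≤ max(1, c^{q−5}) ∫_{−c²}^{−1} ∫_{ℝ³} |u|^q`
(in `ℝ≥0∞`; "`≤ (min{1, λ^{5−p}})⁻¹ Σ_k ∫_{−λ²}^{−1}∫_{D_k}|u|ᵖ ≤ C(λ−1)‖u‖ᵖ_{L^∞(−λ²,−1;Lᵖ)}`",
the last step being Tonelli on the slab). Proof as printed: split `(−∞,0)` into the blocks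
`B_k`, bound the weight on each block (`weight_le_on_timeBlock`), change variables
(`lintegral_block_eq`), and resum the disjoint annuli `D_k` inside `ℝ³`. [cite: ChaeWolf2017RemovingDSS, §2 Step 3, (2.3)–(2.5) (arXiv p. 6)] -/
theorem lintegral_weighted_annulus_le {c : ℝ} (hc : 1 < c) {u : ℝ → EuclideanSpace ℝ (Fin 3) → F}
    (h : IsDiscretelySelfSimilar c u) {q : ℝ} (hq : 0 < q) :
    ∫⁻ z in Iio (0 : ℝ) ×ˢ {x : EuclideanSpace ℝ (Fin 3) | 1 ≤ ‖x‖ ∧ ‖x‖ < c},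
        ‖u z.1 z.2‖ₑ ^ q * ENNReal.ofReal ((-z.1) ^ ((q - 5) / 2)) ≤
      ENNReal.ofReal (max 1 (c ^ (q - 5))) *
        ∫⁻ z in Ioc (-c ^ 2) (-1) ×ˢ (univ : Set (EuclideanSpace ℝ (Fin 3))),
          ‖u z.1 z.2‖ₑ ^ q := by
  have hc0 : 0 < c := one_pos.trans hc
  set M : ℝ := max 1 (c ^ (q - 5)) with hM
  have hM0 : 0 ≤ M := le_trans zero_le_one (le_max_left _ _)
  -- notation for the sets
  set A₁ : Set (EuclideanSpace ℝ (Fin 3)) := {x | 1 ≤ ‖x‖ ∧ ‖x‖ < c} with hA₁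
  set B : ℤ → Set ℝ := fun k => Ioc (-(c ^ 2) ^ (k + 1)) (-(c ^ 2) ^ k) with hB
  set D : ℤ → Set (EuclideanSpace ℝ (Fin 3)) := fun k =>
    {y | c ^ (-k) ≤ ‖y‖ ∧ ‖y‖ < c * c ^ (-k)} with hD
  set g : ℝ × EuclideanSpace ℝ (Fin 3) → ℝ≥0∞ := fun z => ‖u z.1 z.2‖ₑ ^ q with hg
  -- Step 1: split the time axis into blocks
  have hS : Iio (0 : ℝ) ×ˢ A₁ = ⋃ k : ℤ, B k ×ˢ A₁ := by
    rw [← iUnion_prod_const, iUnion_timeBlock hc]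
  have hSm : ∀ k, MeasurableSet (B k ×ˢ A₁) := fun k =>
    measurableSet_Ioc.prod (measurableSet_annulus 1 c)
  have hSd : Pairwise (Disjoint on fun k : ℤ => B k ×ˢ A₁) := fun i j hij =>
    Set.disjoint_prod.2 (Or.inl (pairwise_disjoint_timeBlock hc hij))
  rw [hS, lintegral_iUnion hSm hSd]
  -- Step 2: the bound on each block
  have hblock : ∀ k : ℤ, ∫⁻ z in B k ×ˢ A₁, g z * ENNReal.ofReal ((-z.1) ^ ((q - 5) / 2)) ≤
      ENNReal.ofReal M * ∫⁻ z in Ioc (-c ^ 2) (-1) ×ˢ D k, g z := by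
    intro k
    have hg0k : 0 < (c ^ 2) ^ k := zpow_pos (by positivity) k
    set W : ℝ := M * ((c ^ 2) ^ k) ^ ((q - 5) / 2) with hW
    -- pointwise weight bound on the block
    have h1 : ∫⁻ z in B k ×ˢ A₁, g z * ENNReal.ofReal ((-z.1) ^ ((q - 5) / 2)) ≤
        ∫⁻ z in B k ×ˢ A₁, ENNReal.ofReal W * g z := by
      refine lintegral_mono_ae ((ae_restrict_mem (hSm k)).mono fun z hz => ?_)
      rw [mul_comm]
      exact mul_le_mul' (ENNReal.ofReal_le_ofReal (weight_le_on_timeBlock hc k q hz.1)) le_rfl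
    rw [lintegral_const_mul' _ _ ENNReal.ofReal_ne_top, lintegral_block_eq hc h k hq, ← mul_assoc,
      ← ENNReal.ofReal_mul (by rw [hW]; positivity)] at h1
    have h2 : W * (c ^ (-k)) ^ (q - 5) = M := by
      rw [hW, mul_assoc, block_factors_cancel hc k q, mul_one]
    rwa [h2] at h1
  -- Step 3: resum
  calc ∑' k : ℤ, ∫⁻ z in B k ×ˢ A₁, g z * ENNReal.ofReal ((-z.1) ^ ((q - 5) / 2))
      ≤ ∑' k : ℤ, ENNReal.ofReal M * ∫⁻ z in Ioc (-c ^ 2) (-1) ×ˢ D k, g z :=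
        ENNReal.tsum_le_tsum hblock
    _ = ENNReal.ofReal M * ∑' k : ℤ, ∫⁻ z in Ioc (-c ^ 2) (-1) ×ˢ D k, g z := ENNReal.tsum_mul_left
    _ = ENNReal.ofReal M * ∫⁻ z in ⋃ k : ℤ, Ioc (-c ^ 2) (-1) ×ˢ D k, g z := by
        rw [lintegral_iUnion (fun k => measurableSet_Ioc.prod (measurableSet_annulus _ _))
          (fun i j hij => Set.disjoint_prod.2 (Or.inr (pairwise_disjoint_annulus hc hij)))]
    _ ≤ ENNReal.ofReal M * ∫⁻ z in Ioc (-c ^ 2) (-1) ×ˢ (univ : Set (EuclideanSpace ℝ (Fin 3))), g z := by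
        refine mul_le_mul' le_rfl (lintegral_mono_set ?_)
        exact iUnion_subset fun k => prod_mono Subset.rfl (subset_univ _)

end ChaeWolfDecay

end Literature.Analysis.FluidPDE

end
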